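import Literature.AlgebraicGeometry.Resolution.ThreefoldResolutionDatum
import HarnessLib

/-!
# Cutkosky 2009, Theorem 7.2 (the stable form of a resolution datum) and the finiteness step of §8 — named facts (statement only)

Topic: `Literature/AlgebraicGeometry/Resolution`. TWO NAMED FACTS, statements only (no proof is
attempted; the procedural, per-step facts of §8 — algorithms (9) and (10) — are in
`ThreefoldResolutionAlgorithms.lean`), over the vocabulary of `ThreefoldResolutionDatum.lean` (`Cutkosky2009.ResDatum`,
`Reach`, `Stable`, `FinSing`), transcribing from S. D. Cutkosky, *Resolution of singularities for
3-folds in positive characteristic*, Amer. J. Math. **131** (2009) 59–127 [Cutkosky2009] (held author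
version `paper:doi-10-1353-ajm-0-0036`, "pNN Lmm" = page, line of its text layer):

* **Theorem 7.2** (p21 L15–21, VERBATIM): "Let `R = (∅, E, I, V)`. Then there exists a sequence of
  permissible transforms `π : V_1 → V` such that if `R_1` is the transform of `R` on `V_1`, then
  1. `Sing_r(R_1) ∩ E_1⁻ = ∅`, so that `η(p) = 0` for `p ∈ Sing_r(R_1)`. 2. `Sing_r(R_1) ⊂ E_1⁺` and
  `dim Sing_r(R_1) ≤ 1`. 3. All irreducible curves `C ⊂ Sing_r(R_1)` are nonsingular. 4. If
  `p ∈ Sing_r(R_1)`, then there exists an approximate hypersurface `D_p` of `I_1` at `p` which is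
  transversal to `E_1⁺` and is not a component of `E_1⁺`." (Standing hypotheses of §7, p20 L85–88:
  "`V` is a nonsingular 3-fold (a 3-dimensional variety over an algebraically closed field `k`) and
  `R` is a resolution datum on `V` with `r = ν(R) ≥ 1`." Proof: p21 L22 – p23 L27.)
* **§8, the first finiteness step** (p24 L5–37): "We may assume that the conclusions of Theorem 7.2
  hold (but we now have `R = (E⁺, E⁻, I, V)`). … We may thus construct a sequence of permissible
  transforms (9) `⋯ → V_n → V_{n−1} → ⋯ → V_1 → V` by applying the following algorithm: 1. If there
  exists an irreducible curve `C ⊂ Sing_r(R_n)` then perform the permissible transform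
  `V_{n+1} → V_n` obtained by blowing up `C`. 2. If `Sing_r(R_n)` is a finite set of points, then blow
  up a point in `Sing_r(R_n)`. As remarked in the paragraph above (9), the above blow ups are
  permissible, and the conclusions of Theorem 7.2 hold for all transforms `R_n` of `R` along the
  sequence (9). … We first observe that there exists a `V_n` in (9) such that `Sing_r(R_n)` is a
  finite set. Suppose otherwise. … a contradiction to Remark 6.2 to Theorem 6.1. We may thus assume
  that `Sing_r(R)` is a finite set." (PRINTED WITH PROOF as the first half of §8.)

These are the nodes `Node.Thm72` ("`∀ R, ∃ R', Reach R R' ∧ Stable R'`") and `Node.Alg9`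
("`∀ R, Stable R → ∃ R', Reach R R' ∧ Stable R' ∧ FinSing R'`") of the abstract proof skeleton
`Literature.AlgebraicGeometry.Cutkosky2009.DatumReduction.Sig56` (`thm56_of_nodes`), given their
geometric meaning; an instantiation of `Sig56` whose `Datum` is (a predicate-restricted copy of)
`Cutkosky2009.ResDatum k` takes them BY NAME. The remaining nodes of that skeleton (`RunOfNonterm`,
`ZR`, `SingNonempty`, `SingMono`, `InfGenuine`: statements about the infinite-run object of
algorithm (10) and the Zariski–Riemann space; `TauMono`, `Tau3`, `Sec9`, `Thm1018`: the `τ`-constant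
tails, typed at chain level in `CutkoskySurfaceOmegaSequence.lean` / `CutkoskyTauTwoSequence.lean` /
`CutkoskyOrderTauBlowup.lean`) are NOT stated here.

## Faithfulness notes

* Both facts are ∃-statements IMPLIED by the printed ones: Thm. 7.2 as printed; for §8 the printed
  claim is about the specific algorithm (9), whose steps are permissible transforms preserving the
  conclusions of Thm. 7.2 (p24 L24–25), so "some `V_n` of (9) has `Sing_r(R_n)` finite" yields a datum
  REACHED from `R` by permissible transforms which is stable with finite singular locus — the form
  stated. Nothing stronger than print is asserted; no bound, no canonicity.
* Standing hypotheses (k algebraically closed, `V` a nonsingular quasi-projective 3-fold, `I ≠ 0`,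
  `r = ν(R) ≥ 1` carried as "`r ≥ 1`, `ν ≤ r`") are the fields of `ResDatum` plus `[IsAlgClosed k]`;
  for `r > ν(R)` the datum is already resolved and both conclusions hold trivially
  (`Cutkosky2009_thm_7_2.conclusion_of_resolved`, `Cutkosky2009_sec8_step9.conclusion_of_resolved`,
  PROVED), so the `r`-convention adds nothing.
* AI transcription; AI review is weaker than expert review. Users take `(h : Cutkosky2009_thm_7_2)`,
  `(h : Cutkosky2009_sec8_step9)`.
-/

noncomputable section

namespace Literature.AlgebraicGeometry.Resolution

universe u

open CategoryTheory AlgebraicGeometry TopologicalSpace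

/-- NAMED FACT — **Cutkosky 2009, Theorem 7.2 (the stable form)**: "Let `R = (∅, E, I, V)`. Then
there exists a sequence of permissible transforms `π : V_1 → V` such that if `R_1` is the transform
of `R` on `V_1`, then 1. `Sing_r(R_1) ∩ E_1⁻ = ∅` … 2. `Sing_r(R_1) ⊂ E_1⁺` and `dim Sing_r(R_1) ≤ 1`.
3. All irreducible curves `C ⊂ Sing_r(R_1)` are nonsingular. 4. If `p ∈ Sing_r(R_1)`, then there
exists an approximate hypersurface `D_p` of `I_1` at `p` which is transversal to `E_1⁺` and is not a
component of `E_1⁺`" (p21 L15–21; `V` a nonsingular 3-fold over an algebraically closed field,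
`r = ν(R) ≥ 1`, p20 L85–88). Rendered over `Cutkosky2009.ResDatum` (Def. 5.4 with `r`), `Reach`
(finite sequences of permissible transforms with the `E^±` rule of p19 L5–9) and `Stable`
(conclusions (1)–(4), (4) expansion-free): for every datum with `E⁺ = ∅` there is a reachable
stable datum — the shape of `Sig56`'s `Node.Thm72`. Users take `(h : Cutkosky2009_thm_7_2)`.
[cite: Cutkosky2009, Thm. 7.2 (author version p. 21 l. 15–21)] -/
def Cutkosky2009_thm_7_2 : Prop :=
  ∀ (k : Type u) [Field k] [IsAlgClosed k] (R : Cutkosky2009.ResDatum k), R.Eplus = [] →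
    ∃ R' : Cutkosky2009.ResDatum k, R.Reach R' ∧ R'.Stable

/-- NAMED FACT — **Cutkosky 2009, §8, the first finiteness step ("there exists a `V_n` in (9) such
that `Sing_r(R_n)` is a finite set")**: for a resolution datum `R = (E⁺, E⁻, I, V)` on a nonsingular
3-fold over an algebraically closed field for which the conclusions of Thm. 7.2 hold, the sequence
(9) of permissible transforms (blow up an irreducible curve of `Sing_r` while there is one) keeps
the conclusions of Thm. 7.2 (p24 L12–13, L24–25) and reaches a `V_n` with `Sing_r(R_n)` finite
(p24 L27–37, proved there from Lemma 5.2 and Remark 6.2 to Thm. 6.1). Rendered in the shape of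
`Sig56`'s `Node.Alg9`: every stable datum reaches, by permissible transforms, a stable datum with
finite singular locus. Users take `(h : Cutkosky2009_sec8_step9)`.
[cite: Cutkosky2009, §8 (author version p. 24 l. 5–37)] -/
def Cutkosky2009_sec8_step9 : Prop :=
  ∀ (k : Type u) [Field k] [IsAlgClosed k] (R : Cutkosky2009.ResDatum k), R.Stable →
    ∃ R' : Cutkosky2009.ResDatum k, R.Reach R' ∧ R'.Stable ∧ R'.FinSing

namespace Cutkosky2009_thm_7_2

variable {k : Type u} [Field k] [IsAlgClosed k]

omit [IsAlgClosed k] in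
/-- Non-vacuity of the conclusion shape: a RESOLVED datum (`Sing_r = ∅`) is its own stable form
(empty sequence). [cite: Cutkosky2009, Thm. 7.2 (p. 21 l. 15–21), case `Sing_r = ∅`] -/
theorem conclusion_of_resolved (R : Cutkosky2009.ResDatum k) (h : R.Resolved) :
    ∃ R' : Cutkosky2009.ResDatum k, R.Reach R' ∧ R'.Stable :=
  ⟨R, Cutkosky2009.ResDatum.Reach.refl R, h.stable⟩

/-- **Thm. 7.2 followed by the finiteness step of §8**: from `R = (∅, E, I, V)` one reaches a stable
datum with `Sing_r` finite — the standing situation "With the assumptions that `Sing_r(I)` is a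
finite set of points, and that the conclusions of Theorem 7.2 hold" of algorithm (10) (p24 L38–39).
[cite: Cutkosky2009, §8 (p. 24 l. 5–39)] -/
theorem reach_stable_finSing (h72 : Cutkosky2009_thm_7_2.{u}) (h9 : Cutkosky2009_sec8_step9.{u})
    (R : Cutkosky2009.ResDatum k) (hE : R.Eplus = []) :
    ∃ R' : Cutkosky2009.ResDatum k, R.Reach R' ∧ R'.Stable ∧ R'.FinSing := by
  obtain ⟨R₁, h₁, hs₁⟩ := h72 k R hE
  obtain ⟨R₂, h₂, hs₂, hf₂⟩ := h9 k R₁ hs₁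
  exact ⟨R₂, h₁.trans h₂, hs₂, hf₂⟩

end Cutkosky2009_thm_7_2

namespace Cutkosky2009_sec8_step9

variable {k : Type u} [Field k] [IsAlgClosed k]

omit [IsAlgClosed k] in
/-- Non-vacuity of the conclusion shape: a resolved datum is stable with finite (empty) singular
locus. [cite: Cutkosky2009, §8 (p. 24 l. 38–51), case `Sing_r = ∅`] -/
theorem conclusion_of_resolved (R : Cutkosky2009.ResDatum k) (h : R.Resolved) :
    ∃ R' : Cutkosky2009.ResDatum k, R.Reach R' ∧ R'.Stable ∧ R'.FinSing :=
  ⟨R, Cutkosky2009.ResDatum.Reach.refl R, h.stable, h.finSing⟩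

end Cutkosky2009_sec8_step9

end Literature.AlgebraicGeometry.Resolution

end
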